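import Summits.Ventures.PercRepro.Night2TwoZeroGeneric
import Summits.Ventures.PercRepro.Night2TwoOneGeneric
import Summits.Ventures.PercRepro.Night2ThreeTwoResidues

/-!
# PercRepro — **THE `(7, 5)` SHADOW ROW MODULO THE RESIDUES V: every cell is closed outside its nested-line part**
(night-2, gen 24)

`shadowHall_seven_five_of_residuesV`: `ShadowHall M 7 5 (phiK 7 5)` for every finite matroid modulo the STRUCTURED
parts of the three `c′ < 0` cells — in each, a fat non-basis member AND (at least two fat thin closures, or a thin
member missing a few points: `3 … 4` at `(2, 0)`, `3 … 6` at `(2, 1)`, exactly `3` at `(3, 2)`).  The generic parts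
are `localShadowHall_twozero_five_generic`, `localShadowHall_twoone_five_generic`,
`localShadowHall_three_two_five_generic` at every size; `(3, 0)` and `(3, 1)` are closed entirely.
-/

namespace PercRepro.Shadow

open Finset PerFlat ThmH

section SevenFiveV

variable {α' : Type} [DecidableEq α']

/-- **THE `(7, 5)` SHADOW ROW FOR EVERY FINITE MATROID MODULO THE RESIDUES V**. -/
theorem shadowHall_seven_five_of_residuesV
    (h20 : ∀ (N : Matroid α') [N.Finite] (G : Finset α'), CellHyp N G →
      (gr N \ G).card = 2 → kColoops N G = 0 → FatMember N G 6 3 →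
      (FatBasis N G 6 2 ∨ FatMember N G 6 2) →
      (2 ≤ (fatClosures N 5 G 2).card ∨
        ∃ B ∈ thinMembers N 5 G, 2 < (G \ clF N B).card ∧ (G \ clF N B).card < 5) →
      LocalShadowHall N 5 G)
    (h21 : ∀ (N : Matroid α') [N.Finite] (G : Finset α'), CellHyp N G →
      (gr N \ G).card = 2 → kColoops N G = 1 → FatMember N G 5 4 →
      (FatBasis N G 5 3 ∨ FatMember N G 5 3) →
      (2 ≤ (fatClosures N 5 G 2).card ∨
        ∃ B ∈ thinMembers N 5 G, 2 < (G \ clF N B).card ∧ (G \ clF N B).card < 7) →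
      LocalShadowHall N 5 G)
    (h32 : ∀ (N : Matroid α') [N.Finite] (G : Finset α'), CellHyp N G →
      (gr N \ G).card = 3 → kColoops N G = 2 → FatMember N G 4 2 →
      (2 ≤ (fatClosures N 5 G 2).card ∨ ∃ B ∈ thinMembers N 5 G, (G \ clF N B).card = 3) →
      LocalShadowHall N 5 G)
    (M : Matroid α') [M.Finite] : ShadowHall M 7 5 (phiK 7 5) := by
  apply shadowHall_seven_five_of_residuesU _ _ h32
  · -- the cell (2, 0)
    intro N _ G hcell hd hk hfm hor
    by_cases hstr : 2 ≤ (fatClosures N 5 G 2).card ∨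
        ∃ B ∈ thinMembers N 5 G, 2 < (G \ clF N B).card ∧ (G \ clF N B).card < 5
    · exact h20 N G hcell hd hk hfm hor hstr
    · push Not at hstr
      have hG := hcell.2.2.2
      have hd' : (gr N \ G).card ≤ 5 := by omega
      obtain ⟨B₀, hB₀, -, hf₀⟩ := hfm
      have hc2 : (G \ clF N B₀).card = 2 := by
        have h2 := two_le_card_sdiff_of_not_lay0 hG hd' (mem_thinMembers.1 hB₀).1 (mem_thinMembers.1 hB₀).2
        by_contra hne
        have := hstr.2 B₀ hB₀ (by omega)
        omega
      obtain ⟨p, x, hpx, hP⟩ := Finset.card_eq_two.1 hc2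
      refine localShadowHall_twozero_five_generic hG hd hk hcell.1 hcell.2.1 (by omega)
        (fun B hB h2 => hstr.2 B hB h2) hpx ?_ ?_
      · intro a ha
        exact notMem_coloops_of_mem_sdiff_clF hG hd' hB₀ (hP ▸ ha)
      · have := eRk_clF_le_of_mem_thinMembers hB₀
        rwa [clF_eq_sdiff_sdiff_of_thin hB₀, hP] at this
  · -- the cell (2, 1)
    intro N _ G hcell hd hk hfm hor
    by_cases hstr : 2 ≤ (fatClosures N 5 G 2).card ∨
        ∃ B ∈ thinMembers N 5 G, 2 < (G \ clF N B).card ∧ (G \ clF N B).card < 7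
    · exact h21 N G hcell hd hk hfm hor hstr
    · push Not at hstr
      have hG := hcell.2.2.2
      have hd' : (gr N \ G).card ≤ 5 := by omega
      obtain ⟨B₀, hB₀, -, hf₀⟩ := hfm
      have hc2 : (G \ clF N B₀).card = 2 := by
        have h2 := two_le_card_sdiff_of_not_lay0 hG hd' (mem_thinMembers.1 hB₀).1 (mem_thinMembers.1 hB₀).2
        by_contra hne
        have := hstr.2 B₀ hB₀ (by omega)
        omega
      obtain ⟨p, x, hpx, hP⟩ := Finset.card_eq_two.1 hc2
      refine localShadowHall_twoone_five_generic hG hd hk hcell.1 hcell.2.1 (by omega)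
        (fun B hB h2 => hstr.2 B hB h2) hpx ?_ ?_
      · intro a ha
        exact notMem_coloops_of_mem_sdiff_clF hG hd' hB₀ (hP ▸ ha)
      · have := eRk_clF_le_of_mem_thinMembers hB₀
        rwa [clF_eq_sdiff_sdiff_of_thin hB₀, hP] at this

end SevenFiveV

end PercRepro.Shadow
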